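import Summits.QuantumFields.YangMills.Theorems.BalabanUVNodesK2AtBetaOfRecord13ChainFree
import Literature.MathematicalPhysics.QuantumFieldTheory.Balaban1983to89.Node00.Record13CoPR

/-!
# DAG node N26 ∕ crux K2 — THE N26 ∕ K2 FACES AT def-T's v1.6 RUN-INDEXED-RESIDUAL CORE DATUM AND RECORD `Node00.datumOfRecord₁₃CoPR θ (hc : θ.Provisos₁₃CoPR F N)` ∕
# `Node00.IsRecordOfRecord₁₃CCoPR F N D w`, `θ : Node00.Stage13RParams F N` (def-T FILE 25 `Node00/Record13CoPR.lean` p529474 = v1.6 `CoPR`: director-ym №169 H1 ∕ №174 PRESS WORD —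
# FINDING №8, `structure Stage13RParams extends Stage13Params` with the run-indexed residual 𝐓-weight slot `Zr`, token map `θ.Zt p.K ↦ θ.Zr p`; the bg-free proviso core re-issued as
# `Stage13RParams.Provisos₁₃CoPR`; β, numerics and every Stage-≤13 field read through `θ.toStage13Params`) — the key the v1.6 item edition `SepCoPR` maps to
# (`datumOfRecord₁₃SepCoPR_eq_coPR`, `IsRecordOfRecord₁₃CSepCoPR.toCoPR`)

Cell `pub-ymgap`, YM-PLAN Track A (HUMAN RULING D-0062), seat `pub-ymgap-dag-n26-c` gen 10 (R134 acceleration seat, s2); helper for crux K2⁵ `EndpointGivenBR13SepCoP` (stmt-QuantumFields-20295) → K2⁶ on the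
v1.6 `SepCoPR` edition (plan g69 rev 22, director-ym №174 (2)–(3): pens port their own files by token map).  = my v1.5 leaf p522893 `…N26AtRecord13CoP` under def-T's
KEYMAP v1.6 (`CoP ↦ CoPR`, `Provisos₁₃Core ↦ Provisos₁₃CoPR`, `θ : Stage13RParams`, β at `θ.toStage13Params`); the Co image of this seat's p510090 (`…N26AtRecord13Core`, keyed at the pre-152 sibling `datumOfRecord₁₃Core`) and p512371 §0–§1, written over
this lineage's DATUM-GENERIC roads (p509259 `…K2AtBetaOfRecord13ChainFree`: `hD : D.βfun = betaOfRecord₁₃ F N θ.toStage13Params`, here `βfun_datumOfRecord₁₃CoPR`, `rfl`) so that nothing but def-T's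
names is edition-specific; plus p504252 §2's RECORD-LEVEL faces over `IsRecordOfRecord₁₃CCoPR` (clause order `∃ θ (h : θ.Provisos₁₃CoPR F N), θ.Admissible ∧ D = datumOfRecord₁₃CoPR θ h ∧ w.C =
D.C ∧ (0 < w.γ ∧ w.γ ≤ θ.γ) ∧ …`, identical to every edition predicate).

WHAT IS HERE (0 `def`, 0 `sorry`; each proof `rfl`-level or ONE application of a landed theorem):
* §0 at the Co datum: `n26_datumOfRecord₁₃CoPR_of_betaContH` (universal adapter), `haltsOutside_datumOfRecord₁₃CoPR` (modelling clause 3 = `RGMachineCore.haltsOutside` of `coreOfRecord₁₃CoPR θ`),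
  `endpoint_and_n26_datumOfRecord₁₃CoPR_of_residue_atSlopeCont` (REGISTERED currency), ★ `endpoint_and_n26_datumOfRecord₁₃CoPR_of_drift_atSlopeCont` (jets-free pair), ★
  `endpoint_and_n26_datumOfRecord₁₃CoPR_of_merged_cont_upper_sign` (chain-free merged sign-triple; no `beta0OfMerged`, no chain), ★ `endpointExistence_datumOfRecord₁₃CoPR_iff_topRuns` (END ⟺ «no
  backsliding from the top» under B4 + (U) + non-crossing) and `…_iff_topRuns_merged` (B4 ∕ (U) read on β_m).
* §1 at a Co record `(D, w)`: `n26_of_isRecordOfRecord₁₃CCoPR_of_atSlopeCont`, `endpoint_and_n26_of_isRecordOfRecord₁₃CCoPR_of_residue_atSlopeCont`, ★ `…_of_drift_atSlopeCont`, ★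
  `…_of_merged_cont_upper_sign` (per admissible presentation on the world's own window `]0, w.γ]`).
USE: at the v1.6 item edition take `hc := h.toCore` (datum by `datumOfRecord₁₃SepCoPR_eq_coPR`, `rfl`) resp. `IsRecordOfRecord₁₃CSepCoPR.toCoPR`.  β is edition-free (`betaOfRecord₁₃ θ.toStage13Params` reads
`TcanOfRecord`, `chiFixed29`, `εbg`, `ρ8`, `bV`, `v₀`, `γ` only — no 𝐓-weight, no residual slot, no background), so every face is p509259 ∕ p512371 ∕ Gaps at `hD := rfl`.

HONEST FRAMING.  Re-keying bookkeeping; every antecedent (B4, (U), sign, non-crossing, residue, `AtSlopeCont`, drift) is a displayed HYPOTHESIS proved nowhere for Bałaban's objects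
(instance 0∕1); nothing of Bałaban's analysis asserted; K2 ∕ `stub_d1Residue13` ∕ `stub_d4AtSlopeCont13` NOT proved; N25 ∕ N26 NOT discharged (N26 VACATED ∕ (D4)-dependent; counts
unmoved 5∕27 · A 5∕28); general `N`; one finite four-torus programme at fixed ε per run — NOT the continuum limit, NOT ℝ⁴, NOT OS, NOT a mass gap, NOT Clay.  No `instance`, no `notation`,
no `axiom`.
Sources (context): [I] = [Balaban1987RG1] CMP **109** (1987): Thm 2 p. 259 (first sentence), (0.18)–(0.20) pp. 255–256, (0.31) p. 259, (1.20)–(1.22) p. 264, (2.12)–(2.14) p. 268;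
[II] = [Balaban1988RG2Cluster] CMP **116** (1988): Lemma 3 (2.38) p. 20, (2.41) p. 21; [6] = [Balaban1989LargeFieldII] CMP **122** (1989): Thm 1 + (0.1) pp. 355–356, (1.7)∕(1.9) p. 77.
-/

noncomputable section

open scoped Matrix.Norms.L2Operator

namespace Summit.QuantumFields.YangMills.Theorems.BalabanUVNodesN26AtRecord13CoPR

open Literature.MathematicalPhysics.QuantumFieldTheory.Balaban1983to89
open Literature.MathematicalPhysics.QuantumFieldTheory.Balaban1983to89.FlowStep
open Literature.MathematicalPhysics.QuantumFieldTheory.Balaban1983to89.DagBinding (EndpointExistence WorldP)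
open Literature.MathematicalPhysics.QuantumFieldTheory.Balaban1983to89.T4Continuum (T4Family FiniteEpsData)
open Literature.MathematicalPhysics.QuantumFieldTheory.Balaban1983to89.Node00
open Literature.MathematicalPhysics.QuantumFieldTheory.Balaban1983to89.Beta.OneStepKernelFamily (TbalOf)
open Literature.MathematicalPhysics.QuantumFieldTheory.Balaban1983to89.Beta.OneStepResolventKernel (JetData)
open Literature.MathematicalPhysics.QuantumFieldTheory.Balaban1983to89.Beta.Drift (OneLoopDrift)
open Summit.QuantumFields.BalabanUV.Gaps
open Summit.QuantumFields.BalabanUV.Gaps.BetaContFromD4Chain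
open Summit.QuantumFields.YangMills.Theorems.BalabanUVNodesK2AtBetaOfRecord13ChainFree
  (endpoint_and_n26_of_drift_atSlopeCont₁₃' endpoint_and_n26_of_merged_cont_upper_sign₁₃ betaUpperH_betaOfRecord₁₃_iff)
open Summit.QuantumFields.YangMills.Theorems.BalabanUVNodesN26AtRecord13 (betaContH_betaOfRecord₁₃_iff)
open Summit.QuantumFields.BalabanUV.Gaps.EndRunwiseHeadline (endpointExistence_datum_iff_topRuns)
open Literature.MathematicalPhysics.QuantumFieldTheory.Balaban1983to89.FlowStepRuns (HaltsOutside)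
open Literature.MathematicalPhysics.QuantumFieldTheory.Balaban1983to89.T4DatumAssembly
open Filter Topology

variable (F : T4Family) (N : ℕ) [NeZero N]

/-! ## §0 At the Co datum `datumOfRecord₁₃CoPR θ hc` -/

section AtDatum

variable (θ : Stage13RParams F N)

/-- **THE UNIVERSAL ADAPTER AT THE Co DATUM**: any `BetaContH γ₀ (betaOfRecord₁₃ F N θ.toStage13Params)` face with `0 < γ₀` ⟹ N26's literal at `datumOfRecord₁₃CoPR θ hc` (`βfun_datumOfRecord₁₃CoPR`, `rfl`).
Instance 0∕1; N26 NOT discharged. [cite: Balaban1987RG1, (1.20)–(1.22) p.264; Balaban1989LargeFieldII, Thm 1 + (0.1) pp.355–356] -/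
theorem n26_datumOfRecord₁₃CoPR_of_betaContH (hc : θ.Provisos₁₃CoPR F N) {γ₀ : ℝ} (hγ₀ : 0 < γ₀) (h : BetaContH γ₀ (betaOfRecord₁₃ F N θ.toStage13Params)) :
    ∃ γc : ℝ, 0 < γc ∧ BetaContH γc (datumOfRecord₁₃CoPR F N θ hc).βfun :=
  ⟨γ₀, hγ₀, h⟩

/-- **`HaltsOutside` AT THE Co DATUM** (`RGMachineCore.haltsOutside` of `coreOfRecord₁₃CoPR θ` over `towerOfRecord₁₃CoPR θ hc`; `rfl`-level). [cite: Balaban1987RG1, (0.18)–(0.20) pp.255–256 (bookkeeping)] -/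
theorem haltsOutside_datumOfRecord₁₃CoPR (hc : θ.Provisos₁₃CoPR F N) :
    HaltsOutside (datumOfRecord₁₃CoPR F N θ hc).C.toB12 (betaOfRecord₁₃ F N θ.toStage13Params) :=
  (coreOfRecord₁₃CoPR F N θ).haltsOutside (towerOfRecord₁₃CoPR F N θ hc).ρ

/-- **N25's END ∧ N26 AT THE Co DATUM, REGISTERED (residue) CURRENCY** (`Gaps.BetaContFromD4Chain.endpointExistence_of_residue_atSlopeCont` at the datum's own `fwd`). Instance 0∕1.
[cite: Balaban1987RG1, Thm 2 p.259 (first sentence), (1.20)–(1.22) p.264 and (2.12)–(2.14) p.268; Balaban1988RG2Cluster, Lemma 3 (2.38) p.20] -/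
theorem endpoint_and_n26_datumOfRecord₁₃CoPR_of_residue_atSlopeCont (hc : θ.Provisos₁₃CoPR F N)
    (Sβ : B12Beta.OneLoopSplit (datumOfRecord₁₃CoPR F N θ hc).βfun) {Lc : ℕ} [NeZero Lc] (Js : ℕ → JetData 3 Lc) {Nc : ℝ} {μ ν : Fin 4}
    (hβ : ∀ j, Sβ.β0 j = B12Beta.secondMoment (TbalOf Lc Js j) μ ν) (h1 : D1Residue.Residue Lc Js Nc μ ν) {γ₀ : ℝ} (hγ₀ : 0 < γ₀)
    (hres : AtSlopeCont Sβ γ₀ (B12Normalization.stepBal Nc Lc)) :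
    EndpointExistence (datumOfRecord₁₃CoPR F N θ hc).C.toB12 ∧ ∃ γc : ℝ, 0 < γc ∧ BetaContH γc (datumOfRecord₁₃CoPR F N θ hc).βfun :=
  ⟨endpointExistence_of_residue_atSlopeCont (datumOfRecord₁₃CoPR F N θ hc).fwd Sβ Js hβ h1 hγ₀ hres, γ₀, hγ₀, betaContH_of_atSlopeCont hres⟩

/-- **★ K2 AT θ FROM THE JETS-FREE PAIR, AT THE Co DATUM** (p509259 `endpoint_and_n26_of_drift_atSlopeCont₁₃'` at `hD := βfun_datumOfRecord₁₃CoPR`). Instance 0∕1; N25 ∕ N26 NOT discharged.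
[cite: Balaban1987RG1, Thm 2 p.259 (first sentence), (1.20)–(1.22) p.264 and (2.12)–(2.14) p.268; Balaban1988RG2Cluster, Lemma 3 (2.38) p.20 and (2.41) p.21] -/
theorem endpoint_and_n26_datumOfRecord₁₃CoPR_of_drift_atSlopeCont (hc : θ.Provisos₁₃CoPR F N) {d A γ₀ : ℝ}
    (hdrift : letI := θ.instVβ₁; letI := θ.instVβ₂; letI := θ.instιβ
      OneLoopDrift d A
        (beta0OfMerged (betaMerged F (mergedTermFamilyMatT F N (TcanOfRecord F N) (chiFixed29 F N θ.ν θ.ε₂₉) θ.εbg) θ.ρ8 θ.bV) θ.v₀))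
    (hγ₀ : 0 < γ₀)
    (hres : letI := θ.instVβ₁; letI := θ.instVβ₂; letI := θ.instιβ
      AtSlopeCont
        (oneLoopSplit_betaOfMerged (betaMerged F (mergedTermFamilyMatT F N (TcanOfRecord F N) (chiFixed29 F N θ.ν θ.ε₂₉) θ.εbg) θ.ρ8 θ.bV)
          (beta0OfMerged (betaMerged F (mergedTermFamilyMatT F N (TcanOfRecord F N) (chiFixed29 F N θ.ν θ.ε₂₉) θ.εbg) θ.ρ8 θ.bV) θ.v₀) θ.γ)
        γ₀ d) :
    EndpointExistence (datumOfRecord₁₃CoPR F N θ hc).C.toB12 ∧ ∃ γc : ℝ, 0 < γc ∧ BetaContH γc (datumOfRecord₁₃CoPR F N θ hc).βfun :=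
  endpoint_and_n26_of_drift_atSlopeCont₁₃' F N θ.toStage13Params _ (βfun_datumOfRecord₁₃CoPR F N θ hc) hdrift hγ₀ hres

/-- **★ K2's CONSEQUENT ∧ N26 AT THE Co DATUM FROM THE THREE MERGED-β SENTENCES ON A BOX** `]0,γ₀]^{k+1}`, `0 < γ₀ ≤ θ.γ` (p509259 `endpoint_and_n26_of_merged_cont_upper_sign₁₃` at
`hD := βfun_datumOfRecord₁₃CoPR`): no `beta0OfMerged`, no split, no jets, no chain.  Instance 0∕1. [cite: Balaban1987RG1, Thm 2 p.259 (first sentence), (0.31) p.259 and (1.20)–(1.22) p.264] -/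
theorem endpoint_and_n26_datumOfRecord₁₃CoPR_of_merged_cont_upper_sign (hc : θ.Provisos₁₃CoPR F N) {γ₀ β' : ℝ} (hγ₀ : 0 < γ₀) (hle : γ₀ ≤ θ.γ) (hβ' : 0 ≤ β')
    (hcont : letI := θ.instVβ₁; letI := θ.instVβ₂; letI := θ.instιβ
      ∀ k, ContinuousOn (betaMerged F (mergedTermFamilyMatT F N (TcanOfRecord F N) (chiFixed29 F N θ.ν θ.ε₂₉) θ.εbg) θ.ρ8 θ.bV k) (Box γ₀ k))
    (hhi : letI := θ.instVβ₁; letI := θ.instVβ₂; letI := θ.instιβ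
      ∀ k (v : Fin (k + 1) → ℝ), v ∈ Box γ₀ k →
        betaMerged F (mergedTermFamilyMatT F N (TcanOfRecord F N) (chiFixed29 F N θ.ν θ.ε₂₉) θ.εbg) θ.ρ8 θ.bV k v ≤ β')
    (hsign : letI := θ.instVβ₁; letI := θ.instVβ₂; letI := θ.instιβ
      ∀ (k : ℕ) (gs : ℕ → ℝ), (∀ i, i ≤ k → 0 < gs i ∧ gs i ≤ γ₀) → (∀ i j, i ≤ j → j ≤ k → gs i ≤ gs j) →
        0 ≤ betaMerged F (mergedTermFamilyMatT F N (TcanOfRecord F N) (chiFixed29 F N θ.ν θ.ε₂₉) θ.εbg) θ.ρ8 θ.bV k (prefixOf gs k)) :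
    EndpointExistence (datumOfRecord₁₃CoPR F N θ hc).C.toB12 ∧ ∃ γc : ℝ, 0 < γc ∧ BetaContH γc (datumOfRecord₁₃CoPR F N θ hc).βfun :=
  endpoint_and_n26_of_merged_cont_upper_sign₁₃ F N θ.toStage13Params _ (βfun_datumOfRecord₁₃CoPR F N θ hc) hγ₀ hle hβ' hcont hhi hsign

/-- **★ K2's CONSEQUENT AT THE Co DATUM ⟺ THE TOP-RUN CONDITION** (`Gaps.EndRunwiseHeadline.endpointExistence_datum_iff_topRuns` with `HaltsOutside` DISCHARGED by §0), under N26's B4 + (U) +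
non-crossing for `betaOfRecord₁₃ F N θ.toStage13Params`.  Neither side proved (instance 0∕1). [cite: Balaban1987RG1, Thm 2 p.259 (first sentence) and (0.20) p.256] -/
theorem endpointExistence_datumOfRecord₁₃CoPR_iff_topRuns (hc : θ.Provisos₁₃CoPR F N) {γ₀ β' : ℝ} (hγ₀ : 0 < γ₀) (hβ' : 0 ≤ β')
    (hcont : BetaContH γ₀ (betaOfRecord₁₃ F N θ.toStage13Params)) (hhi : BetaUpperH β' γ₀ (betaOfRecord₁₃ F N θ.toStage13Params))
    (hord : ∀ γ : ℝ, 0 < γ → γ ≤ γ₀ → ∀ (n : ℕ) (gs gs' : ℕ → ℝ), RGEqH n (betaOfRecord₁₃ F N θ.toStage13Params) gs → RGEqH n (betaOfRecord₁₃ F N θ.toStage13Params) gs' →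
      Step.InInterval γ n gs → Step.InInterval γ n gs' → gs 0 < gs' 0 → ∀ k, k ≤ n → gs k < gs' k) :
    EndpointExistence (datumOfRecord₁₃CoPR F N θ hc).C.toB12 ↔
      ∃ γ₂ : ℝ, 0 < γ₂ ∧ ∀ γ : ℝ, 0 < γ → γ ≤ γ₂ → ∃ gstar : ℝ, 0 < gstar ∧
        ∀ (n : ℕ) (gs : ℕ → ℝ), RGEqH n (betaOfRecord₁₃ F N θ.toStage13Params) gs → Step.InInterval γ n gs → ∀ k, k ≤ n → gs k = γ → gstar ≤ gs n :=
  endpointExistence_datum_iff_topRuns (datumOfRecord₁₃CoPR F N θ hc) (haltsOutside_datumOfRecord₁₃CoPR F N θ hc) hγ₀ hβ' hcont hhi hord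

/-- **The top-run equivalence at the Co datum with B4 and (U) READ ON THE MERGED β** on `]0,γ₀]^{k+1}` (`0 < γ₀ ≤ θ.γ`; p491248 `betaContH_betaOfRecord₁₃_iff`, p509259
`betaUpperH_betaOfRecord₁₃_iff`).  Instance 0∕1. [cite: Balaban1987RG1, Thm 2 p.259 (first sentence), (0.31) p.259 and (1.20)–(1.22) p.264] -/
theorem endpointExistence_datumOfRecord₁₃CoPR_iff_topRuns_merged (hc : θ.Provisos₁₃CoPR F N) {γ₀ β' : ℝ} (hγ₀ : 0 < γ₀) (hle : γ₀ ≤ θ.γ) (hβ' : 0 ≤ β')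
    (hcont : letI := θ.instVβ₁; letI := θ.instVβ₂; letI := θ.instιβ
      ∀ k, ContinuousOn (betaMerged F (mergedTermFamilyMatT F N (TcanOfRecord F N) (chiFixed29 F N θ.ν θ.ε₂₉) θ.εbg) θ.ρ8 θ.bV k) (Box γ₀ k))
    (hhi : letI := θ.instVβ₁; letI := θ.instVβ₂; letI := θ.instιβ
      ∀ k (v : Fin (k + 1) → ℝ), v ∈ Box γ₀ k →
        betaMerged F (mergedTermFamilyMatT F N (TcanOfRecord F N) (chiFixed29 F N θ.ν θ.ε₂₉) θ.εbg) θ.ρ8 θ.bV k v ≤ β')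
    (hord : ∀ γ : ℝ, 0 < γ → γ ≤ γ₀ → ∀ (n : ℕ) (gs gs' : ℕ → ℝ), RGEqH n (betaOfRecord₁₃ F N θ.toStage13Params) gs → RGEqH n (betaOfRecord₁₃ F N θ.toStage13Params) gs' →
      Step.InInterval γ n gs → Step.InInterval γ n gs' → gs 0 < gs' 0 → ∀ k, k ≤ n → gs k < gs' k) :
    EndpointExistence (datumOfRecord₁₃CoPR F N θ hc).C.toB12 ↔
      ∃ γ₂ : ℝ, 0 < γ₂ ∧ ∀ γ : ℝ, 0 < γ → γ ≤ γ₂ → ∃ gstar : ℝ, 0 < gstar ∧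
        ∀ (n : ℕ) (gs : ℕ → ℝ), RGEqH n (betaOfRecord₁₃ F N θ.toStage13Params) gs → Step.InInterval γ n gs → ∀ k, k ≤ n → gs k = γ → gstar ≤ gs n :=
  endpointExistence_datumOfRecord₁₃CoPR_iff_topRuns F N θ hc hγ₀ hβ' ((betaContH_betaOfRecord₁₃_iff F N θ.toStage13Params hle).2 hcont)
    ((betaUpperH_betaOfRecord₁₃_iff F N θ.toStage13Params hle β').2 hhi) hord

end AtDatum

/-! ## §1 At a Co record `(D, w)` over `IsRecordOfRecord₁₃CCoPR` -/

/-- **N26 AT A Co RECORD `(D, w)` FROM THE RESIDUE ON THE WORLD's OWN WINDOW**: if every admissible Co presentation `θ` (with `hc : θ.Provisos₁₃CoPR F N`) of `D` with `w.γ ≤ θ.γ` carries, at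
SOME split of `D`'s β and SOME slope, `AtSlopeCont Sβ w.γ s`, then `∃ γc > 0, BetaContH γc D.βfun` (`γc := w.γ`).  At the v1.6 edition record use `IsRecordOfRecord₁₃CSepCoPR.toCoPR`.  Instance 0∕1; N26
NOT discharged. [cite: Balaban1987RG1, (1.20)–(1.22) p.264; Balaban1988RG2Cluster, Lemma 3 (2.38) p.20; Balaban1989LargeFieldII, Thm 1 p.355 (the record)] -/
theorem n26_of_isRecordOfRecord₁₃CCoPR_of_atSlopeCont {D : FiniteEpsData F (Matrix.specialUnitaryGroup (Fin N) ℂ)} {w : WorldP}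
    (h : IsRecordOfRecord₁₃CCoPR F N D w)
    (hin : ∀ (θ : Stage13RParams F N) (hc : θ.Provisos₁₃CoPR F N), θ.Admissible F N → D = datumOfRecord₁₃CoPR F N θ hc → w.γ ≤ θ.γ →
      ∃ (Sβ : B12Beta.OneLoopSplit D.βfun) (s : ℝ), AtSlopeCont Sβ w.γ s) :
    ∃ γc : ℝ, 0 < γc ∧ BetaContH γc D.βfun := by
  obtain ⟨θ, hc, hθ, hD, -, ⟨hγ0, hγle⟩, -, -⟩ := h
  obtain ⟨Sβ, s, hs⟩ := hin θ hc hθ hD hγle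
  exact ⟨w.γ, hγ0, betaContH_of_atSlopeCont hs⟩

/-- **N25's END ∧ N26 AT A Co RECORD `(D, w)`, REGISTERED (residue) CURRENCY**: per admissible Co presentation on the world's window, row (D1)'s residue pinned on a split of `D`'s β and
`AtSlopeCont` at its slope ⟹ `EndpointExistence D.C.toB12 ∧ ∃ γc > 0, BetaContH γc D.βfun`.  Instance 0∕1; N25 ∕ N26 NOT discharged.
[cite: Balaban1987RG1, Thm 2 p.259 (first sentence) and (1.20)–(1.22) p.264; Balaban1988RG2Cluster, Lemma 3 (2.38) p.20; Balaban1989LargeFieldII, Thm 1 p.355] -/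
theorem endpoint_and_n26_of_isRecordOfRecord₁₃CCoPR_of_residue_atSlopeCont {D : FiniteEpsData F (Matrix.specialUnitaryGroup (Fin N) ℂ)} {w : WorldP}
    (h : IsRecordOfRecord₁₃CCoPR F N D w)
    (hin : ∀ (θ : Stage13RParams F N) (hc : θ.Provisos₁₃CoPR F N), θ.Admissible F N → D = datumOfRecord₁₃CoPR F N θ hc → w.γ ≤ θ.γ →
      ∃ (Sβ : B12Beta.OneLoopSplit D.βfun) (Lc : ℕ) (_ : NeZero Lc) (Js : ℕ → JetData 3 Lc) (Nc : ℝ) (μ ν : Fin 4),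
        (∀ j, Sβ.β0 j = B12Beta.secondMoment (TbalOf Lc Js j) μ ν) ∧ D1Residue.Residue Lc Js Nc μ ν ∧
        AtSlopeCont Sβ w.γ (B12Normalization.stepBal Nc Lc)) :
    EndpointExistence D.C.toB12 ∧ ∃ γc : ℝ, 0 < γc ∧ BetaContH γc D.βfun := by
  obtain ⟨θ, hc, hθ, hD, -, ⟨hγ0, hγle⟩, -, -⟩ := h
  obtain ⟨Sβ, Lc, _, Js, Nc, μ, ν, hβ, h1, hres⟩ := hin θ hc hθ hD hγle
  subst hD
  exact ⟨endpointExistence_of_residue_atSlopeCont (datumOfRecord₁₃CoPR F N θ hc).fwd Sβ Js hβ h1 hγ0 hres, w.γ, hγ0, betaContH_of_atSlopeCont hres⟩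

/-- **★ N25's END ∧ N26 AT A Co RECORD `(D, w)` FROM THE JETS-FREE PAIR PER PRESENTATION**: a drift `OneLoopDrift d A β⁰_θ` of the presentation's one-loop numbers + `AtSlopeCont (split₁₃ θ) w.γ d`
on the world's window ⟹ `EndpointExistence D.C.toB12 ∧ ∃ γc > 0, BetaContH γc D.βfun` (p509259's datum-generic drift road after `subst`).  Instance 0∕1; N25 ∕ N26 NOT discharged.
[cite: Balaban1987RG1, Thm 2 p.259 (first sentence), (1.20)–(1.22) p.264 and (2.12)–(2.14) p.268; Balaban1988RG2Cluster, Lemma 3 (2.38) p.20 and (2.41) p.21] -/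
theorem endpoint_and_n26_of_isRecordOfRecord₁₃CCoPR_of_drift_atSlopeCont {D : FiniteEpsData F (Matrix.specialUnitaryGroup (Fin N) ℂ)} {w : WorldP}
    (h : IsRecordOfRecord₁₃CCoPR F N D w)
    (hin : ∀ (θ : Stage13RParams F N) (hc : θ.Provisos₁₃CoPR F N), θ.Admissible F N → D = datumOfRecord₁₃CoPR F N θ hc → w.γ ≤ θ.γ →
      letI := θ.instVβ₁; letI := θ.instVβ₂; letI := θ.instιβ
      ∃ d A : ℝ,
        OneLoopDrift d A (beta0OfMerged (betaMerged F (mergedTermFamilyMatT F N (TcanOfRecord F N) (chiFixed29 F N θ.ν θ.ε₂₉) θ.εbg) θ.ρ8 θ.bV) θ.v₀) ∧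
        AtSlopeCont
          (oneLoopSplit_betaOfMerged (betaMerged F (mergedTermFamilyMatT F N (TcanOfRecord F N) (chiFixed29 F N θ.ν θ.ε₂₉) θ.εbg) θ.ρ8 θ.bV)
            (beta0OfMerged (betaMerged F (mergedTermFamilyMatT F N (TcanOfRecord F N) (chiFixed29 F N θ.ν θ.ε₂₉) θ.εbg) θ.ρ8 θ.bV) θ.v₀) θ.γ)
          w.γ d) :
    EndpointExistence D.C.toB12 ∧ ∃ γc : ℝ, 0 < γc ∧ BetaContH γc D.βfun := by
  obtain ⟨θ, hc, hθ, hD, -, ⟨hγ0, hγle⟩, -, -⟩ := h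
  obtain ⟨d, A, hdrift, hres⟩ := hin θ hc hθ hD hγle
  subst hD
  exact endpoint_and_n26_of_drift_atSlopeCont₁₃' F N θ.toStage13Params _ (βfun_datumOfRecord₁₃CoPR F N θ hc) hdrift hγ0 hres

/-- **★ N25's END ∧ N26 AT A Co RECORD `(D, w)` FROM THE CHAIN-FREE MERGED SIGN-TRIPLE PER PRESENTATION ON THE WORLD's WINDOW** `]0, w.γ]^{k+1}` (`w.γ ≤ θ.γ` is a clause of the record):
some `β' ≥ 0` with per-`k` continuity of `β_m k` on the box, `β_m ≤ β'` there, and `0 ≤ β_m` at non-decreasing histories ⟹ `EndpointExistence D.C.toB12 ∧ ∃ γc > 0, BetaContH γc D.βfun`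
(p509259's datum-generic sign road after `subst`) — no `beta0OfMerged`, no split, no jets, no chain.  Instance 0∕1; N25 ∕ N26 NOT discharged.
[cite: Balaban1987RG1, Thm 2 p.259 (first sentence), (0.31) p.259 and (1.20)–(1.22) p.264] -/
theorem endpoint_and_n26_of_isRecordOfRecord₁₃CCoPR_of_merged_cont_upper_sign {D : FiniteEpsData F (Matrix.specialUnitaryGroup (Fin N) ℂ)} {w : WorldP}
    (h : IsRecordOfRecord₁₃CCoPR F N D w)
    (hin : ∀ (θ : Stage13RParams F N) (hc : θ.Provisos₁₃CoPR F N), θ.Admissible F N → D = datumOfRecord₁₃CoPR F N θ hc → w.γ ≤ θ.γ →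
      letI := θ.instVβ₁; letI := θ.instVβ₂; letI := θ.instιβ
      ∃ β' : ℝ, 0 ≤ β' ∧
        (∀ k, ContinuousOn (betaMerged F (mergedTermFamilyMatT F N (TcanOfRecord F N) (chiFixed29 F N θ.ν θ.ε₂₉) θ.εbg) θ.ρ8 θ.bV k) (Box w.γ k)) ∧
        (∀ k (v : Fin (k + 1) → ℝ), v ∈ Box w.γ k →
          betaMerged F (mergedTermFamilyMatT F N (TcanOfRecord F N) (chiFixed29 F N θ.ν θ.ε₂₉) θ.εbg) θ.ρ8 θ.bV k v ≤ β') ∧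
        (∀ (k : ℕ) (gs : ℕ → ℝ), (∀ i, i ≤ k → 0 < gs i ∧ gs i ≤ w.γ) → (∀ i j, i ≤ j → j ≤ k → gs i ≤ gs j) →
          0 ≤ betaMerged F (mergedTermFamilyMatT F N (TcanOfRecord F N) (chiFixed29 F N θ.ν θ.ε₂₉) θ.εbg) θ.ρ8 θ.bV k (prefixOf gs k))) :
    EndpointExistence D.C.toB12 ∧ ∃ γc : ℝ, 0 < γc ∧ BetaContH γc D.βfun := by
  obtain ⟨θ, hc, hθ, hD, -, ⟨hγ0, hγle⟩, -, -⟩ := h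
  obtain ⟨β', hβ', hcont, hhi, hsign⟩ := hin θ hc hθ hD hγle
  subst hD
  exact endpoint_and_n26_of_merged_cont_upper_sign₁₃ F N θ.toStage13Params _ (βfun_datumOfRecord₁₃CoPR F N θ hc) hγ0 hγle hβ' hcont hhi hsign

end Summit.QuantumFields.YangMills.Theorems.BalabanUVNodesN26AtRecord13CoPR

end
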